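import Mathlib.Algebra.Polynomial.Laurent
import Mathlib.Algebra.MvPolynomial.CommRing
import Mathlib.RingTheory.Localization.Away.Basic
import Mathlib.RingTheory.Ideal.Colon
import Mathlib.RingTheory.Ideal.Maps
import HarnessLib

/-!
# Cobordant blow-ups (Włodarczyk 2022), I: the algebra `A[t⁻¹, u₁ t^{w₁}, …, u_k t^{w_k}]`

Topic: `Literature/AlgebraicGeometry/Resolution`. Definition request `defn-CobordantBlowup` of
route `ResolutionOfSingularities/WeightedInvariant` (cruxes WeightedConstruction,
DatumToResolution, LocalWeightedDrop).

J. Włodarczyk, *Functorial resolution by torus actions*, arXiv:2203.03090, Def. 2.3.5: for a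
regular scheme `X` and a (regular, weighted) centre `𝒥 = (u₁^{1/w₁}, …, u_k^{1/w_k})` — the `uᵢ`
part of a system of local parameters, `wᵢ` positive integers — the **full cobordant blow-up**
of `𝒥` is
  `B := Spec_X ( 𝒪_X[t⁻¹, t^{w₁} u₁, …, t^{w_k} u_k] )`,
the relative spectrum of the *extended Rees algebra* of the centre (ibid. §2.2.7
"Regular centers vs. Rees centers": `𝒜_𝒥^ext = 𝒪_X[t⁻¹, u₁ t^{w₁}, …, u_k t^{w_k}] ⊆ 𝒪_X[t, t⁻¹]`),
with the torus `T = 𝔾_m = Spec ℤ[t, t⁻¹]` acting through the `t`-grading; `B₋ := B ∖ V(t⁻¹) =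
X × 𝔾_m` (trivial cobordant blow-up), `B₊ := B ∖ V(t^{w₁} u₁, …, t^{w_k} u_k)` (the cobordant
blow-up `σ₊ : B₊ → X`), `Vert(B) := V(t^{w₁} u₁, …, t^{w_k} u_k)` (the vertex). Locally
(§2.3.9, Remark 2.3.10, with `s = t⁻¹`, `uᵢ' = uᵢ t^{wᵢ}`):
  `B = Spec ( 𝒪_X[s, u₁', …, u_k'] / (uᵢ − s^{wᵢ} uᵢ') )`.
The same algebras appear independently in Quek–Rydh's weighted blow-ups (ibid. Remark 2.3.6);
`[B₊ / 𝔾_m]` is the stack-theoretic weighted blow-up, which is NOT needed and not built here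
(`B`, `B₊` are schemes).

This file is the **affine model** `X = Spec A`, `uᵢ ∈ A` (any commutative ring `A`, any family
`u : ι → A`, weights `w : ι → ℕ`), at the level of rings; the schemes `B = Spec (cobordantAlgebra u w)`,
`B₊`, `σ`, the exceptional divisor and the strict transform of ideal sheaves are in
`CobordantBlowup.lean`.

## Content (namespace `Literature.AlgebraicGeometry.Resolution`)

* `cobordantAlgebra u w : Subalgebra A A[T;T⁻¹]` — `A[t⁻¹, uᵢ t^{wᵢ}]`, the printed form
  (Def. 2.3.5); generators `cobordantAlgebra.s = t⁻¹` and `cobordantAlgebra.u' i = uᵢ t^{wᵢ}`;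
  the relation `algebraMap_u : uᵢ = s^{wᵢ} · uᵢ'` (§2.3.9 / Rem. 2.3.10); an induction principle
  on the generators (`cobordantAlgebra.induction_on`).
* `cobordantAlgebra.presentation : MvPolynomial (Option ι) A →ₐ[A] cobordantAlgebra u w`,
  `X none ↦ s`, `X (some i) ↦ uᵢ'`, surjective (`presentation_surjective`) and killing
  `s^{wᵢ} X_(some i) − uᵢ` (`presentation_relation`): the local description §2.3.9 as a
  surjection `A[s, u'] → 𝒪_B` (it is an isomorphism onto `A[s,u']/(uᵢ − s^{wᵢ} uᵢ')` when the
  `uᵢ` form a regular sequence; not proved here).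
* the `𝔾_m`-action as the `ℤ`-grading by `t`-degree: `cobordantAlgebra.weightSpace n`
  (`t` acts with weight `−1` on `s` and `wᵢ` on `uᵢ'`: `s_mem_weightSpace`, `u'_mem_weightSpace`,
  `weightSpace_mul_mem`), and `iSup_weightSpace_eq_top` (`𝒪_B` is the direct sum of its weight
  spaces, i.e. a graded subalgebra of `A[t, t⁻¹]`).
* `cobordantAlgebra.isLocalization_away_s` — **the trivial cobordant blow-up**: inverting
  `s = t⁻¹` in `𝒪_B` gives `A[t, t⁻¹]`, i.e. `B ∖ V(t⁻¹) = Spec A × 𝔾_m` (Def. 2.3.5, `B₋`).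
* `cobordantAlgebra.vertexIdeal = (u₁', …, u_k')`, `cobordantAlgebra.excIdeal = (s)`.
* `cobordantAlgebra.map_span_pow_eq_span_s_pow` — **Lemma 2.3.8** (`𝒥 · 𝒪_{B₊} = t⁻¹ · 𝒪_{B₊}`)
  in integral form on a chart of `B₊`: if `aᵢ wᵢ = m` for all `i`, then in any algebra over `𝒪_B`
  in which some `uᵢ₀'` is invertible, `(u₁^{a₁}, …, u_k^{a_k})` generates the same ideal as `s^m`;
  `map_span_eq_span_s` is the case of all weights `1` (`(u₁, …, u_k) · 𝒪 = s · 𝒪`).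
* `cobordantAlgebra.strictTransform I = ⋃ₙ (I·𝒪_B : sⁿ)` — the **strict transform** of an ideal
  `I ⊆ A` (§3.3, "Strict transform of ideals": `σˢ(I) = {tᵃ f ∈ 𝒪_B | f ∈ 𝒪_B · I, a ≥ 0}`, the
  `s`-saturation of the total transform, i.e. the ideal of the schematic closure of
  `V(I) × 𝔾_m ⊆ B₋` in `B`), with `mem_strictTransform_iff`, `map_le_strictTransform`,
  `mem_strictTransform_of_s_mul_mem` (saturation).

## Not here (follow-ups)

* the global, non-affine `B = Spec_Y 𝒪_Y[t⁻¹, 𝒥ₙ tⁿ]` for a weighted centre on a general scheme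
  (route: `Literature.AlgebraicGeometry.RelativeSpec.SubringDatum` applied to `Y × 𝔾_m → Y`);
* regularity of `B` for `A` regular and `u` part of a regular system of parameters (§2.3.9:
  "`B` is a regular closed subscheme of `X × 𝔸ⁿ⁺¹`");
* Lemma 4.6.1 (all weights `1`: `B₊ → Bl_𝒥(X)` is a Zariski-locally trivial `𝔾_m`-bundle; chart
  `𝒪_{B_{uᵢ t}} = 𝒪_X[u_j/u_i][uᵢ t, (uᵢ t)⁻¹]`).

## Sources

* J. Włodarczyk, *Functorial resolution by torus actions*, arXiv:2203.03090 (version of July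
  2025): Def. 2.3.5, Rem. 2.3.6, Lemma 2.3.8, §2.3.9, Rem. 2.3.10 (PDF pp. 10–11), §3.3
  (strict/controlled transforms), Lemma 4.6.1, App. §5.1. [Wlodarczyk2022]
* D. Abramovich, M. Temkin, J. Włodarczyk, *Functorial embedded resolution via weighted
  blowings up*, Algebra & Number Theory 18 (2024), §3.1 (stack-theoretic weighted blow-ups).
  [AbramovichTemkinWlodarczyk2024]
-/

noncomputable section

open scoped LaurentPolynomial
open LaurentPolynomial

namespace Literature.AlgebraicGeometry.Resolution

universe u v

variable {A : Type u} [CommRing A] {ι : Type v} (u : ι → A) (w : ι → ℕ)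

/-- The **algebra of the full cobordant blow-up** of the weighted centre
`𝒥 = (u₁^{1/w₁}, …, u_k^{1/w_k})` on `Spec A` (Włodarczyk, Def. 2.3.5): the extended Rees algebra
`𝒜_𝒥^ext = A[t⁻¹, u₁ t^{w₁}, …, u_k t^{w_k}]`, as an `A`-subalgebra of the Laurent polynomial ring
`A[t, t⁻¹]` (here `t = T 1`). Defined for any commutative ring `A`, any family `u : ι → A` and
weights `w : ι → ℕ`; in the source `A` is regular, the `uᵢ` are part of a regular system of
parameters and the `wᵢ` are positive. The full cobordant blow-up is `B = Spec (cobordantAlgebra u w)`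
(`CobordantBlowup.lean`). [cite: Wlodarczyk2022, Def. 2.3.5] -/
def cobordantAlgebra : Subalgebra A A[T;T⁻¹] :=
  Algebra.adjoin A (insert (T (-1)) (Set.range fun i : ι => C (u i) * T (w i : ℤ)))

namespace cobordantAlgebra

/-- `t⁻¹ ∈ A[t⁻¹, uᵢ t^{wᵢ}]`. [folklore] -/
theorem T_neg_one_mem : (T (-1) : A[T;T⁻¹]) ∈ cobordantAlgebra u w :=
  Algebra.subset_adjoin (Set.mem_insert _ _)

/-- `uᵢ t^{wᵢ} ∈ A[t⁻¹, uᵢ t^{wᵢ}]`. [folklore] -/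
theorem C_mul_T_mem (i : ι) : C (u i) * T (w i : ℤ) ∈ cobordantAlgebra u w :=
  Algebra.subset_adjoin (Set.mem_insert_of_mem _ ⟨i, rfl⟩)

/-- The generator `s := t⁻¹` of `𝒪_B = A[t⁻¹, uᵢ t^{wᵢ}]` (Włodarczyk, Rem. 2.3.10: "it is
convenient to substitute `s = t⁻¹`"); `V(s) ∩ B₊` is the exceptional divisor (Lemma 2.3.8).
[cite: Wlodarczyk2022, Rem. 2.3.10] -/
def s : cobordantAlgebra u w := ⟨T (-1), T_neg_one_mem u w⟩

/-- The generator `uᵢ' := uᵢ t^{wᵢ}` of `𝒪_B` (Włodarczyk, §2.3.9: `xᵢ' = xᵢ · t^{wᵢ}`; in §3.3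
called the controlled transform `σᶜ(uᵢ)` of the coordinate `uᵢ`); the vertex of `B` is
`V(u₁', …, u_k')`. [cite: Wlodarczyk2022, §2.3.9] -/
def u' (i : ι) : cobordantAlgebra u w := ⟨C (u i) * T (w i : ℤ), C_mul_T_mem u w i⟩

/-- `s = t⁻¹` in `A[t, t⁻¹]`. [folklore] -/
@[simp] theorem coe_s : ((s u w : cobordantAlgebra u w) : A[T;T⁻¹]) = T (-1) := rfl

/-- `uᵢ' = uᵢ t^{wᵢ}` in `A[t, t⁻¹]`. [folklore] -/
@[simp] theorem coe_u' (i : ι) :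
    ((u' u w i : cobordantAlgebra u w) : A[T;T⁻¹]) = C (u i) * T (w i : ℤ) := rfl

/-- The structure map `A → 𝒪_B` is `a ↦ C a`. [folklore] -/
@[simp] theorem coe_algebraMap (a : A) :
    ((algebraMap A (cobordantAlgebra u w) a : cobordantAlgebra u w) : A[T;T⁻¹]) = C a := rfl

/-- `sⁿ = t⁻ⁿ`. [folklore] -/
@[simp] theorem coe_s_pow (n : ℕ) :
    (((s u w) ^ n : cobordantAlgebra u w) : A[T;T⁻¹]) = T (-(n : ℤ)) := by
  rw [SubmonoidClass.coe_pow, coe_s, T_pow]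
  congr 1
  ring

/-- `t⁻ⁿ ∈ 𝒪_B` for `n ≥ 0`. [folklore] -/
theorem T_neg_natCast_mem (n : ℕ) : (T (-(n : ℤ)) : A[T;T⁻¹]) ∈ cobordantAlgebra u w := by
  rw [← coe_s_pow u w n]
  exact ((s u w) ^ n).2

/-- `a · t⁻ⁿ ∈ 𝒪_B` for `a ∈ A`, `n ≥ 0`: `A[t⁻¹] ⊆ 𝒪_B`. [folklore] -/
theorem C_mul_T_neg_natCast_mem (a : A) (n : ℕ) :
    C a * T (-(n : ℤ)) ∈ cobordantAlgebra u w :=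
  mul_mem (by rw [C_eq_algebraMap]; exact Subalgebra.algebraMap_mem _ a) (T_neg_natCast_mem u w n)

/-- **The local equations of `B`** (Włodarczyk, §2.3.9 and Rem. 2.3.10: `xᵢ = xᵢ' s^{wᵢ}`): in
`𝒪_B` one has `uᵢ = s^{wᵢ} · uᵢ'`. [cite: Wlodarczyk2022, §2.3.9] -/
theorem algebraMap_u (i : ι) :
    algebraMap A (cobordantAlgebra u w) (u i) = s u w ^ w i * u' u w i := by
  apply Subtype.ext
  rw [coe_algebraMap, MulMemClass.coe_mul, coe_s_pow, coe_u', T_mul, mul_T_assoc,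
    add_neg_cancel, T_zero, mul_one]

/-- **Induction on the generators of `𝒪_B`**: a property holding for the constants `a ∈ A`, for
`s` and for the `uᵢ'`, and stable under `+` and `·`, holds on all of `A[t⁻¹, uᵢ t^{wᵢ}]`.
[folklore] -/
theorem induction_on {p : cobordantAlgebra u w → Prop} (f : cobordantAlgebra u w)
    (algebraMap : ∀ a : A, p (algebraMap A (cobordantAlgebra u w) a)) (s : p (s u w))
    (u' : ∀ i, p (u' u w i)) (add : ∀ f g, p f → p g → p (f + g))
    (mul : ∀ f g, p f → p g → p (f * g)) : p f := by
  obtain ⟨f, hf⟩ := f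
  induction hf using Algebra.adjoin_induction with
  | mem x hx =>
    rcases hx with rfl | ⟨i, rfl⟩
    · exact s
    · exact u' i
  | algebraMap a => exact algebraMap a
  | add x y hx hy hpx hpy => exact add ⟨x, hx⟩ ⟨y, hy⟩ hpx hpy
  | mul x y hx hy hpx hpy => exact mul ⟨x, hx⟩ ⟨y, hy⟩ hpx hpy

/-! ## The presentation `A[s, u'] → 𝒪_B` (local description, §2.3.9) -/

/-- **The presentation of `𝒪_B` by the polynomial ring `A[s, u₁', …, u_k']`** (Włodarczyk,
§2.3.9: `B = Spec (𝒪_X[t⁻¹, x₁', …, x_k'] / (xᵢ' t^{-wᵢ} − xᵢ))`): the `A`-algebra map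
`A[X_none, X_(some i)] → 𝒪_B`, `X_none ↦ s`, `X_(some i) ↦ uᵢ'`. It is surjective
(`presentation_surjective`) and kills the printed relations (`presentation_relation`).
[cite: Wlodarczyk2022, §2.3.9] -/
def presentation : MvPolynomial (Option ι) A →ₐ[A] cobordantAlgebra u w :=
  MvPolynomial.aeval fun o : Option ι => o.elim (s u w) (u' u w)

/-- `X_none ↦ s`. [folklore] -/
@[simp] theorem presentation_X_none : presentation u w (MvPolynomial.X none) = s u w := by
  simp [presentation]

/-- `X_(some i) ↦ uᵢ'`. [folklore] -/
@[simp] theorem presentation_X_some (i : ι) :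
    presentation u w (MvPolynomial.X (some i)) = u' u w i := by
  simp [presentation]

/-- The presentation kills the local equations `s^{wᵢ} uᵢ' − uᵢ` of `B` (§2.3.9). [cite: Wlodarczyk2022, §2.3.9] -/
theorem presentation_relation (i : ι) :
    presentation u w (MvPolynomial.X none ^ w i * MvPolynomial.X (some i) -
      MvPolynomial.C (u i)) = 0 := by
  rw [map_sub, map_mul, map_pow, presentation_X_none, presentation_X_some, MvPolynomial.algHom_C,
    algebraMap_u, sub_self]

/-- **`A[s, u'] → 𝒪_B` is surjective**: `𝒪_B` is generated over `A` by `s` and the `uᵢ'`.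
[cite: Wlodarczyk2022, §2.3.9] -/
theorem presentation_surjective : Function.Surjective (presentation u w) := by
  intro f
  induction f using induction_on with
  | algebraMap a => exact ⟨MvPolynomial.C a, MvPolynomial.algHom_C _ a⟩
  | s => exact ⟨MvPolynomial.X none, presentation_X_none u w⟩
  | u' i => exact ⟨MvPolynomial.X (some i), presentation_X_some u w i⟩
  | add f g hf hg =>
    obtain ⟨P, rfl⟩ := hf
    obtain ⟨Q, rfl⟩ := hg
    exact ⟨P + Q, map_add _ _ _⟩
  | mul f g hf hg =>
    obtain ⟨P, rfl⟩ := hf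
    obtain ⟨Q, rfl⟩ := hg
    exact ⟨P * Q, map_mul _ _ _⟩

/-! ## The `𝔾_m`-action: the grading by `t`-degree -/

/-- **The weight-`n` subspace of `𝒪_B`** for the `𝔾_m`-action of the cobordant blow-up: the
elements of `A[t⁻¹, uᵢ t^{wᵢ}]` of the form `a tⁿ`, `a ∈ A` — the torus `T = Spec ℤ[t, t⁻¹]`
acts on `B = Spec_X 𝒪_X[t⁻¹, uᵢ t^{wᵢ}]` through the `t`-grading (Włodarczyk, Def. 2.3.5 and
§2.3.3: `t · (x₀, x₁, …) = (t⁻¹ x₀, t^{w₁} x₁, …)`), so `s = t⁻¹` has weight `−1` and `uᵢ'` has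
weight `wᵢ`. [cite: Wlodarczyk2022, Def. 2.3.5] -/
def weightSpace (n : ℤ) : Submodule A (cobordantAlgebra u w) where
  carrier := {f | ∃ a : A, (f : A[T;T⁻¹]) = C a * T n}
  add_mem' := by
    rintro f g ⟨a, ha⟩ ⟨b, hb⟩
    exact ⟨a + b, by rw [AddMemClass.coe_add, ha, hb, map_add, add_mul]⟩
  zero_mem' := ⟨0, by rw [ZeroMemClass.coe_zero, map_zero, zero_mul]⟩
  smul_mem' := by
    rintro c f ⟨a, ha⟩
    refine ⟨c * a, ?_⟩
    rw [Subalgebra.coe_smul, ha, smul_eq_C_mul, map_mul, mul_assoc]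

/-- Membership in a weight space. [folklore] -/
theorem mem_weightSpace_iff {n : ℤ} {f : cobordantAlgebra u w} :
    f ∈ weightSpace u w n ↔ ∃ a : A, (f : A[T;T⁻¹]) = C a * T n := Iff.rfl

/-- `s = t⁻¹` has weight `−1`. [cite: Wlodarczyk2022, Def. 2.3.5] -/
theorem s_mem_weightSpace : s u w ∈ weightSpace u w (-1) :=
  ⟨1, by rw [coe_s, map_one, one_mul]⟩

/-- `uᵢ' = uᵢ t^{wᵢ}` has weight `wᵢ`. [cite: Wlodarczyk2022, Def. 2.3.5] -/
theorem u'_mem_weightSpace (i : ι) : u' u w i ∈ weightSpace u w (w i) :=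
  ⟨u i, rfl⟩

/-- The functions from the base `A` have weight `0` (`σ : B → Spec A` is `𝔾_m`-invariant).
[folklore] -/
theorem algebraMap_mem_weightSpace (a : A) :
    algebraMap A (cobordantAlgebra u w) a ∈ weightSpace u w 0 :=
  ⟨a, by rw [coe_algebraMap, T_zero, mul_one]⟩

/-- Weights add under multiplication. [folklore] -/
theorem weightSpace_mul_mem {m n : ℤ} {f g : cobordantAlgebra u w} (hf : f ∈ weightSpace u w m)
    (hg : g ∈ weightSpace u w n) : f * g ∈ weightSpace u w (m + n) := by
  obtain ⟨a, ha⟩ := hf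
  obtain ⟨b, hb⟩ := hg
  refine ⟨a * b, ?_⟩
  rw [MulMemClass.coe_mul, ha, hb, map_mul, T_add]
  ring

/-- **`𝒪_B` is graded**: every element of `A[t⁻¹, uᵢ t^{wᵢ}]` is a (finite) sum of elements of
the weight spaces — the subalgebra is generated by homogeneous elements, so the `𝔾_m`-action on
`Spec A[t, t⁻¹] = Spec A × 𝔾_m` extends to `B`. [folklore] -/
theorem iSup_weightSpace_eq_top : ⨆ n : ℤ, weightSpace u w n = ⊤ := by
  rw [eq_top_iff]
  rintro f -
  induction f using induction_on with
  | algebraMap a => exact Submodule.mem_iSup_of_mem 0 (algebraMap_mem_weightSpace u w a)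
  | s => exact Submodule.mem_iSup_of_mem (-1) (s_mem_weightSpace u w)
  | u' i => exact Submodule.mem_iSup_of_mem _ (u'_mem_weightSpace u w i)
  | add f g hf hg => exact Submodule.add_mem _ hf hg
  | mul f g hf hg =>
    induction hf using Submodule.iSup_induction' with
    | mem m f hf =>
      induction hg using Submodule.iSup_induction' with
      | mem n g hg => exact Submodule.mem_iSup_of_mem _ (weightSpace_mul_mem u w hf hg)
      | zero => rw [mul_zero]; exact Submodule.zero_mem _
      | add g₁ g₂ _ _ h₁ h₂ => rw [mul_add]; exact Submodule.add_mem _ h₁ h₂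
    | zero => rw [zero_mul]; exact Submodule.zero_mem _
    | add f₁ f₂ _ _ h₁ h₂ => rw [add_mul]; exact Submodule.add_mem _ h₁ h₂

/-! ## The trivial cobordant blow-up `B ∖ V(s) = Spec A × 𝔾_m` -/

/-- Every Laurent polynomial becomes an element of `A[t⁻¹] ⊆ 𝒪_B` after multiplication by a
power of `s = t⁻¹`. [folklore] -/
theorem exists_mul_T_neg_mem (f : A[T;T⁻¹]) :
    ∃ n : ℕ, f * T (-(n : ℤ)) ∈ cobordantAlgebra u w := by
  induction f using LaurentPolynomial.induction_on' with
  | add p q hp hq =>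
    obtain ⟨m, hm⟩ := hp
    obtain ⟨n, hn⟩ := hq
    refine ⟨m + n, ?_⟩
    have e : (T (-((m + n : ℕ) : ℤ)) : A[T;T⁻¹]) = T (-(m : ℤ)) * T (-(n : ℤ)) := by
      rw [← T_add]; congr 1; push_cast; ring
    rw [add_mul, e, ← mul_assoc, mul_comm (T (-(m : ℤ))) (T (-(n : ℤ))), ← mul_assoc q]
    exact add_mem (mul_mem hm (T_neg_natCast_mem u w n)) (mul_mem hn (T_neg_natCast_mem u w m))
  | C_mul_T n a =>
    refine ⟨n.toNat, ?_⟩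
    rw [mul_assoc, ← T_add]
    have e : n + -((n.toNat : ℕ) : ℤ) = -(((n.toNat : ℤ) - n).toNat : ℤ) := by omega
    rw [e]
    exact C_mul_T_neg_natCast_mem u w a _

/-- **The trivial cobordant blow-up** (Włodarczyk, Def. 2.3.5: `B₋ := B ∖ V(t⁻¹) =
Spec_X 𝒪_X[t, t⁻¹] = X × 𝔾_m`): the Laurent polynomial ring `A[t, t⁻¹]` is the localization of
`𝒪_B = A[t⁻¹, uᵢ t^{wᵢ}]` at `s = t⁻¹`. [cite: Wlodarczyk2022, Def. 2.3.5] -/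
theorem isLocalization_away_s : IsLocalization.Away (s u w) A[T;T⁻¹] := by
  refine IsLocalization.Away.mk (s u w) ?_ ?_ ?_
  · exact isUnit_T (-1)
  · intro z
    obtain ⟨n, hn⟩ := exists_mul_T_neg_mem u w z
    refine ⟨n, ⟨_, hn⟩, ?_⟩
    change z * ((s u w) ^ n : cobordantAlgebra u w).1 = z * T (-(n : ℤ))
    rw [coe_s_pow]
  · intro a b h
    exact ⟨0, by rw [pow_zero, one_mul, one_mul]; exact Subtype.ext h⟩

/-- `s = t⁻¹` is not a zero divisor of `𝒪_B` (it is a unit of `A[t, t⁻¹] ⊇ 𝒪_B`); in particular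
the exceptional divisor `V(s)` is Cartier. [folklore] -/
theorem s_mem_nonZeroDivisors : s u w ∈ nonZeroDivisors (cobordantAlgebra u w) := by
  rw [mem_nonZeroDivisors_iff_right]
  intro f hf
  apply Subtype.ext
  have h := congrArg Subtype.val hf
  rw [MulMemClass.coe_mul, coe_s, ZeroMemClass.coe_zero] at h
  simpa using (isUnit_T (-1 : ℤ)).mul_left_eq_zero.mp h

/-! ## Vertex, exceptional divisor, Lemma 2.3.8 -/

/-- **The ideal of the vertex** `Vert(B) = V(u₁', …, u_k') = V(t^{w₁} u₁, …, t^{w_k} u_k)`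
(Włodarczyk, Def. 2.3.5); its complement is `B₊`. [cite: Wlodarczyk2022, Def. 2.3.5] -/
def vertexIdeal : Ideal (cobordantAlgebra u w) :=
  Ideal.span (Set.range (u' u w))

/-- **The ideal `(s) = (t⁻¹)`** whose zero locus (met with `B₊`) is the exceptional divisor `D`
of the cobordant blow-up (Włodarczyk, Lemma 2.3.8). [cite: Wlodarczyk2022, Lemma 2.3.8] -/
def excIdeal : Ideal (cobordantAlgebra u w) :=
  Ideal.span {s u w}

/-- `uᵢ' ∈ vertexIdeal`. [folklore] -/
theorem u'_mem_vertexIdeal (i : ι) : u' u w i ∈ vertexIdeal u w :=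
  Ideal.subset_span ⟨i, rfl⟩

/-- The centre becomes contained in `(s)`: `uᵢ ∈ s^{wᵢ} 𝒪_B ⊆ s 𝒪_B` for `wᵢ > 0`, so
`V(𝒥 · 𝒪_B) ⊇ V(s)` (half of Lemma 2.3.8: `V(𝒥 · 𝒪_B) = Vert(B) ∪ D`). [cite: Wlodarczyk2022, Lemma 2.3.8] -/
theorem algebraMap_u_mem_excIdeal {i : ι} (hi : 0 < w i) :
    algebraMap A (cobordantAlgebra u w) (u i) ∈ excIdeal u w := by
  rw [algebraMap_u, excIdeal]
  exact Ideal.mul_mem_right _ _ (Ideal.pow_mem_of_mem _ (Ideal.mem_span_singleton_self _) _ hi)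

/-- The centre is also contained in the vertex ideal: `uᵢ = s^{wᵢ} uᵢ' ∈ (u₁', …, u_k')`
(the other half of `V(𝒥 · 𝒪_B) = Vert(B) ∪ D`, Lemma 2.3.8). [cite: Wlodarczyk2022, Lemma 2.3.8] -/
theorem algebraMap_u_mem_vertexIdeal (i : ι) :
    algebraMap A (cobordantAlgebra u w) (u i) ∈ vertexIdeal u w := by
  rw [algebraMap_u]
  exact Ideal.mul_mem_left _ _ (u'_mem_vertexIdeal u w i)

/-- **Lemma 2.3.8 (the exceptional divisor), integral form on a chart of `B₊`.** Włodarczyk: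
"The cobordant blow-up transforms the `ℚ`-ideal center `𝒥` into the ideal of the exceptional
divisor `D = V(t⁻¹)` on `B₊`: `𝒥 · 𝒪_{B₊} = t⁻¹ · 𝒪_{B₊}`." Rendered without `ℚ`-ideals: if
`aᵢ wᵢ = m` for all `i` (e.g. `m = lcm wᵢ`, so that `(u₁^{a₁}, …, u_k^{a_k})` represents `𝒥^m`),
then over any ring `C` over `𝒪_B` in which some `uᵢ₀'` is a unit — the charts
`B₊ = ⋃ᵢ D(uᵢ')` — the ideal generated by the `uᵢ^{aᵢ}` is the principal ideal `(s^m)`.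
[cite: Wlodarczyk2022, Lemma 2.3.8] -/
theorem map_span_pow_eq_span_s_pow {C : Type*} [CommRing C] (φ : cobordantAlgebra u w →+* C)
    {m : ℕ} {a : ι → ℕ} (ha : ∀ i, a i * w i = m) {i₀ : ι} (hi₀ : IsUnit (φ (u' u w i₀))) :
    Ideal.map (φ.comp (algebraMap A (cobordantAlgebra u w))) (Ideal.span (Set.range fun i => u i ^ a i)) =
      Ideal.span {φ (s u w) ^ m} := by
  have key : ∀ i, φ (algebraMap A (cobordantAlgebra u w) (u i)) ^ a i =
      φ (s u w) ^ m * φ (u' u w i) ^ a i := by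
    intro i
    rw [algebraMap_u, map_mul, map_pow, mul_pow, ← pow_mul, mul_comm (w i), ha i]
  apply le_antisymm
  · rw [Ideal.map_span, Ideal.span_le]
    rintro _ ⟨_, ⟨i, rfl⟩, rfl⟩
    rw [RingHom.comp_apply, map_pow, map_pow, key i]
    exact Ideal.mul_mem_right _ _ (Ideal.mem_span_singleton_self _)
  · rw [Ideal.span_singleton_le_iff_mem]
    obtain ⟨v, hv⟩ := hi₀
    have e : φ (s u w) ^ m =
        φ (algebraMap A (cobordantAlgebra u w) (u i₀)) ^ a i₀ * ↑(v⁻¹ ^ a i₀) := by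
      rw [key i₀, ← hv, mul_assoc, ← Units.val_pow_eq_pow_val, ← Units.val_mul, ← mul_pow,
        mul_inv_cancel, one_pow, Units.val_one, mul_one]
    have hmem : (φ.comp (algebraMap A (cobordantAlgebra u w))) (u i₀ ^ a i₀) ∈
        Ideal.map (φ.comp (algebraMap A (cobordantAlgebra u w)))
          (Ideal.span (Set.range fun i => u i ^ a i)) :=
      Ideal.mem_map_of_mem _ (Ideal.subset_span (Set.mem_range_self i₀))
    rw [RingHom.comp_apply, map_pow, map_pow] at hmem
    rw [e]
    exact Ideal.mul_mem_right _ _ hmem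

/-- **Lemma 2.3.8 for weights `1`**: on a chart `D(uᵢ₀')` of `B₊`, the centre `(u₁, …, u_k)`
generates the ideal `(s)` of the exceptional divisor: `𝒥 · 𝒪_{B₊} = s · 𝒪_{B₊}`.
[cite: Wlodarczyk2022, Lemma 2.3.8] -/
theorem map_span_eq_span_s {C : Type*} [CommRing C] (φ : cobordantAlgebra u w →+* C)
    (hw : ∀ i, w i = 1) {i₀ : ι} (hi₀ : IsUnit (φ (u' u w i₀))) :
    Ideal.map (φ.comp (algebraMap A (cobordantAlgebra u w))) (Ideal.span (Set.range u)) =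
      Ideal.span {φ (s u w)} := by
  have h := map_span_pow_eq_span_s_pow u w φ (m := 1) (a := fun _ => 1)
    (fun i => by rw [hw i]) hi₀
  simpa using h

/-! ## Strict transforms (§3.3) -/

/-- **The strict transform `σˢ(I)` of an ideal `I ⊆ A`** under the full cobordant blow-up
`σ : B → Spec A` (Włodarczyk, §3.3 "Strict transform of ideals"): the schematic closure in `B`
of the total transform restricted to `B₋ = B ∖ V(t⁻¹) = Spec A × 𝔾_m`, i.e.
`σˢ(I) = {tᵃ f ∈ 𝒪_B | f ∈ 𝒪_B · I, a ≥ 0} = ⋃ₙ (I · 𝒪_B : sⁿ)`, the `s`-saturation of `I · 𝒪_B`.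
The strict transform of the closed subscheme `V(I)` is `V(σˢ(I))`, the closure of `V(I) × 𝔾_m`.
[cite: Wlodarczyk2022, §3.3] -/
def strictTransform (I : Ideal A) : Ideal (cobordantAlgebra u w) :=
  ⨆ n : ℕ, (I.map (algebraMap A (cobordantAlgebra u w))).colon {s u w ^ n}

/-- The saturation steps `(I·𝒪_B : sⁿ)` increase with `n`. [folklore] -/
theorem colon_s_pow_mono (I : Ideal A) :
    Monotone fun n : ℕ => (I.map (algebraMap A (cobordantAlgebra u w))).colon {s u w ^ n} := by
  refine monotone_nat_of_le_succ fun n f hf => ?_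
  rw [Submodule.mem_colon_singleton, smul_eq_mul] at hf ⊢
  rw [pow_succ, ← mul_assoc]
  exact Ideal.mul_mem_right _ _ hf

/-- **Membership in the strict transform**: `f ∈ σˢ(I) ↔ sⁿ f ∈ I · 𝒪_B` for some `n`
(`σˢ(I) = {tᵃ g | g ∈ 𝒪_B · I}`, Włodarczyk §3.3). [cite: Wlodarczyk2022, §3.3] -/
theorem mem_strictTransform_iff {I : Ideal A} {f : cobordantAlgebra u w} :
    f ∈ strictTransform u w I ↔
      ∃ n : ℕ, s u w ^ n * f ∈ I.map (algebraMap A (cobordantAlgebra u w)) := by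
  rw [strictTransform, Submodule.mem_iSup_of_directed _ (colon_s_pow_mono u w I).directed_le]
  simp only [Submodule.mem_colon_singleton, smul_eq_mul, mul_comm f]

/-- The total transform is contained in the strict transform: `I · 𝒪_B ⊆ σˢ(I)`. [folklore] -/
theorem map_le_strictTransform (I : Ideal A) :
    I.map (algebraMap A (cobordantAlgebra u w)) ≤ strictTransform u w I :=
  fun f hf => (mem_strictTransform_iff u w).mpr ⟨0, by rwa [pow_zero, one_mul]⟩

/-- **`σˢ(I)` is `s`-saturated**: `s f ∈ σˢ(I) → f ∈ σˢ(I)` (the strict transform has no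
component inside the exceptional divisor `V(s)`). [folklore] -/
theorem mem_strictTransform_of_s_mul_mem {I : Ideal A} {f : cobordantAlgebra u w}
    (h : s u w * f ∈ strictTransform u w I) : f ∈ strictTransform u w I := by
  obtain ⟨n, hn⟩ := (mem_strictTransform_iff u w).mp h
  exact (mem_strictTransform_iff u w).mpr ⟨n + 1, by rwa [pow_succ, mul_assoc]⟩

/-- The strict transform is monotone in the ideal. [folklore] -/
theorem strictTransform_mono {I J : Ideal A} (h : I ≤ J) :
    strictTransform u w I ≤ strictTransform u w J := fun f hf => by
  obtain ⟨n, hn⟩ := (mem_strictTransform_iff u w).mp hf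
  exact (mem_strictTransform_iff u w).mpr ⟨n, Ideal.map_mono h hn⟩

/-- The strict transform of the unit ideal (empty subscheme) is the unit ideal. [folklore] -/
theorem strictTransform_top : strictTransform u w (⊤ : Ideal A) = ⊤ :=
  top_le_iff.mp ((le_of_eq (Ideal.map_top _).symm).trans (map_le_strictTransform u w ⊤))

end cobordantAlgebra

end Literature.AlgebraicGeometry.Resolution
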